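import Summits.QuantumFields.BalabanUV.T4Continuum.Support.NE7PairwiseOffsetEnd
import Summits.QuantumFields.BalabanUV.T4Continuum.Support.NE7PairwiseCauchyWindow

/-!
# NE7PairwiseOffsetEndWindow — row NE7 (node U5), route «PAIR-CAUCHY» (R-P2, 1-bis): the WINDOWED (E♭) socket and the
# K-ONLY PAIR BAD CLASS — per-offset good clauses at a FIXED window depth `w`, bad classes indexed by run `K`'s labels
# alone (never by the finer partner, never a union over intermediate runs), null-in-`K` remainders at fixed `w` and
# eventually-light deep bad classes ⟹ node U6's `GenFunCauchy` and node U0, BY NAME; no `Summable W` anywhere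

Cell `pub-balaban`, rung (B)+1 sub-cell t4, lineage `b2b-balaban-t4-ne7-p2` (CRUX PROVER NE7 #2 under the
coordinator ruling «YM redirect», 2026-08-21; generation 54; texts: the crux refuter's `HOME/b2b-balaban-t4-ne7-refuter/
PRICING-NE7.md` v8 §45 «PRECISION on (E♭-inst) … (iii) the pair bad class `Bad K (K+n)`: a union-of-consecutive
construction needs the tail sums Σ_{m ≥ K} W_m → 0, i.e. `Summable W` in costume (stronger than the displayed `W → 0`),
whereas a K-only bad class with UV-uniform one-run large-field sizes is the printed TYPE (B15∕B16 large-field regions are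
per run) — p2 to say which (E♭-inst) intends», `HOME/t4/b2b-balaban-t4-ne7-p2/g54/ROUTE2-NE7-P2.md` v1.9 §12 (the answer:
K-ONLY), ROUTE2 §2 NODE W♭ («for every FIXED window depth w, the relative weight of histories with a large-field ∕ boundary
degree of freedom deeper than w is eventually (in K, uniformly over the finer run K′) ≤ η w, with η w → 0»), and the
headers of `Support/NE7PairwiseOffsetEnd` (p255333: «NOT DELIVERED: … the windowed variant … is not re-socketed here») and
`Support/NE7PairwiseCauchyWindow` (p248170).  HONEST FRAMING (page 1): FIXED FINITE T⁴, rung (B)+1 = existence AND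
uniqueness of the `ε = L^{−K} → 0` limit of unit-scale averaged expectations, CONDITIONAL on BetaPertH and the nine spine
estimates (0/9 proved); NOT infinite volume, NOT a mass gap, NOT the Clay problem.  NE7 is NOT PRINTED in
[Balaban1984PropagatorsI]–[Balaban1989LargeFieldII] and NOT proved here.  Everything below is [folklore] bookkeeping over
HYPOTHESIS SHAPES (abstract finite families of reals); no definition, no cite tag, nothing printed asserted, no `sorry`.

WHY.  `NE7PairwiseOffsetEnd` (p255333) sockets road P1's `GoodClause`, applied once per offset `n = K′ − K`, into the
(K2) hybrid family with ONE remainder `δ K → 0` and ONE bad-class weight `W K → 0`, `W K < 1`.  Two things were left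
open there and are closed here.  (1) THE WINDOW: on PAIR-CAUCHY the depth `w` of the good-class window is a FREE,
`K`-independent parameter (`NE7PairwiseCauchyWindow.pairCauchy_of_windowedHybrid`: double limit, `K → ∞` at fixed `w`,
then `w → ∞` through the deep-bad-class weights `η w → 0`); the windowed data are a family of per-offset good clauses
INDEXED BY `w`, with remainders `δ w K → 0` for each fixed `w` and bad-class weights `W w K ≤ η w` eventually in `K` —
§1 sockets them (`pairBound_of_windowedOffsetGoodClauses`, `pairCauchy_of_windowedOffsetGoodClauses`).  (2) THE SHAPE OF
THE PAIR BAD CLASS (PRICING-NE7 v8 §45 (iii)): in the socket the bad class of a pair `(K, K′)` is a subset of run `K`'s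
labels `T K` with a weight `W K` indexed by the COARSER run; (E♭-inst) intends the K-ONLY printed type — `Bad w K t`, a
predicate of the run-`K` LABEL (a large-field ∕ boundary degree of freedom in the depth-`w` window of run `K`'s levels),
THE SAME SET FOR EVERY FINER PARTNER `K′`: the intermediate runs `K+1, …, K′−1` are never inspected (that is the point of
the pairwise organisation), so NO union over consecutive steps and NO tail sum `Σ_{m ≥ K} W m` ever appears; what is asked
of the finer run is ONE inequality, uniform in `K′` — the relative weight, in run `K′` fibre-summed onto `T K`, of run
`K`'s bad labels is `≤ W w K` (a one-run size of run `K′` READ AT LEVELS `≤ K`, n-free as a SIZE by the UV-uniformity of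
the per-level suppression — rows NE7b ∕ NE7c's printed TYPE — modulo the coupling synchronisation at equal level, docked in
`NE7PairwiseCouplingUniform.couplingGap_uniform`).  §2 states exactly this K-only socket and §3 its exits; §4 records, for
contrast, what the REJECTED union-of-consecutive construction would cost (`sum_biUnion_le_sum_mul`: the weight of
`⋃_{m ∈ [K, K′)} Bad₁ m` is bounded only by the TAIL SUM `(Σ_{m ∈ [K,K′)} W₁ m)·total` — `Summable W₁` in costume).

WHAT IS PROVED ([folklore]).
§1 `pairBound_of_windowedOffsetGoodClauses` (for every window `w` and pair `K ≤ K′`: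
   `|log Z K′ t − log Z K t − c| ≤ vol·δ w K − log(1 − W w K)` — `NE7PairwiseOffsetEnd.pairMatching_of_offsetGoodClauses`
   per window + `T4HybridMatching.mul_hybridDelta`); **`pairCauchy_of_windowedOffsetGoodClauses`** (the `ε–K₀` pair-Cauchy
   statement, by `NE7PairwiseCauchyWindow.pairCauchy_of_windowedHybrid`).
§2 **`pairBound_of_kOnlyBadClasses`**, **`pairCauchy_of_kOnlyBadClasses`** — the same with bad classes `Bad w K t`
   carrying NO finer-run index: run-`K` weight `Σ_{Bad w K t} A K t ≤ W w K·Σ A K t` (one run), finer-run weight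
   `Σ_{Bad w K t} B K K′ t ≤ W w K·Σ B K K′ t` for all `K′ ≥ K` (one inequality, uniform in the partner).
§3 EXITS BY NAME: **`genFunCauchy_of_kOnlyBadClasses`** (node U6 `T4Assembly.GenFunCauchy S l₀`),
   `hasContinuumLimit_of_kOnlyBadClasses` (node U0 via `T4Assembly.hasContinuumLimit_of_genFunCauchy`).
§4 CONTRAST: `sum_biUnion_le_sum_sum_of_nonneg`, `sum_biUnion_le_sum_mul` (a union of per-step bad classes is bounded by
   the SUM of the per-step weights — the tail sum the K-only class never pays).

NOT DELIVERED: the windowed good clauses for Bałaban's runs (road P1's END per offset — (E♭-inst) kinds (i)(ii), the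
supplier rows' asks in the null currency; NODE O is road P1's and is inherited verbatim: its ONE carrier
`Support/NE7EtaBackgroundCarrier.bgCarriers` (p258129) hosts all cutoffs on level-tagged subtypes, and a pair `(K, K′)`
consumes it at the VALUE level through the transitive two-run rates `URateUpTo` — no iterate of the one-step transport is
formed or needed (ROUTE2 v1.9 §12 (a)(d); PRICING-NE7 v8 §45 (ii), v10 §55 (1)); n-uniformity of the remainder is no
longer asked either: the sequence-indexed socket `Support/NE7PairwiseOffsetEndSeq` (p261256) accepts a remainder per
finer-run sequence and proves the uniformity by a diagonal argument), the deep-bad-class bound `W w K ≤ η w` (rows NE7b ∕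
NE7c in null currency).  NOT NE7 (spine 0/9 unchanged), NOT summit progress.  HONEST DEPENDENCY: continuum YM on T⁴ ⇐
BetaPertH ∧ nine spine estimates (0/9 proved); BetaPertH ⇐ (D1) ∧ (D4) ∧ CAP+tail; G-an2-4 gates asym, D1 and NE2/3/4.
(v1.1, generation 55: this paragraph re-worded — the v1 phrase «one-step transport to be iterated for a pair» pre-dated
ROUTE2 v1.9's value-level reading and was flagged by PRICING-NE7 v10 §55 (1) as docstring drift; every declaration below
is byte-identical to v1 p259223.)
-/

noncomputable section

open Finset Filter Topology
open scoped BigOperators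

namespace Summit.QuantumFields.BalabanUV.T4Continuum.NE7PairwiseOffsetEndWindow

open Literature.MathematicalPhysics.QuantumFieldTheory
open Literature.MathematicalPhysics.QuantumFieldTheory.Balaban1983to89
open T4HybridMatching (mul_hybridDelta)
open T4GoodClassBudget (GoodClause)
open Summit.QuantumFields.BalabanUV.T4Continuum.NE7PairwiseOffsetEnd (pairMatching_of_offsetGoodClauses)
open Summit.QuantumFields.BalabanUV.T4Continuum.NE7PairwiseCauchyWindow
  (cauchySeq_genFun_of_pairCauchy pairCauchy_of_windowedHybrid)

/-! ## §1 The windowed socket: per-offset good clauses at every fixed window depth -/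

section Window

variable {ι : Type*} [DecidableEq ι] {l₀ vol : ℝ} {T : ℕ → Finset ι} {A : ℕ → ℝ → ι → ℝ}
  {B : ℕ → ℕ → ℝ → ι → ℝ} {Z : ℕ → ℝ → ℝ}

/-- **THE WINDOWED PAIR BOUND.**  For every window depth `w`: per-offset good clauses (road P1's `GoodClause` for the family
`(A, K ↦ B K (K+n))`, every offset `n`) with remainder `δ w`, bad classes `Bad w K K′ t ⊆ T K` of relative weight `≤ W w K`
in run `K` and in run `K′` fibre-summed, `W w K < 1`, positivity ⟹ for every pair `K ≤ K′`,
`|log Z K′ t − log Z K t − c| ≤ vol·δ w K − log(1 − W w K)` on `|t| ≤ l₀` — the remainder shape consumed by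
`NE7PairwiseCauchyWindow.pairCauchy_of_windowedHybrid`. [folklore] -/
theorem pairBound_of_windowedOffsetGoodClauses {Bad : ℕ → ℕ → ℕ → ℝ → Finset ι} {δ W : ℕ → ℕ → ℝ}
    (hvol : 0 < vol) (hZA : ∀ (K : ℕ) (t : ℝ), |t| ≤ l₀ → Z K t = ∑ τ ∈ T K, A K t τ)
    (hZB : ∀ (K K' : ℕ) (t : ℝ), K ≤ K' → |t| ≤ l₀ → Z K' t = ∑ τ ∈ T K, B K K' t τ)
    (hpos : ∀ (K : ℕ) (t : ℝ), |t| ≤ l₀ → 0 < ∑ τ ∈ T K, A K t τ) (hW1 : ∀ w K, W w K < 1)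
    (hA : ∀ K t, |t| ≤ l₀ → ∀ τ ∈ T K, 0 ≤ A K t τ)
    (hB : ∀ K K' t, K ≤ K' → |t| ≤ l₀ → ∀ τ ∈ T K, 0 ≤ B K K' t τ)
    (hbad : ∀ w K K' t, K ≤ K' → |t| ≤ l₀ → Bad w K K' t ⊆ T K)
    (hWA : ∀ w K K' t, K ≤ K' → |t| ≤ l₀ → ∑ τ ∈ Bad w K K' t, A K t τ ≤ W w K * ∑ τ ∈ T K, A K t τ)
    (hWB : ∀ w K K' t, K ≤ K' → |t| ≤ l₀ → ∑ τ ∈ Bad w K K' t, B K K' t τ ≤ W w K * ∑ τ ∈ T K, B K K' t τ)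
    (hgood : ∀ w n : ℕ, GoodClause l₀ vol T A (fun K => B K (K + n)) (fun K => Bad w K (K + n)) (δ w)) :
    ∀ w K K' : ℕ, K ≤ K' → ∃ c : ℝ, ∀ t : ℝ, |t| ≤ l₀ →
      |Real.log (Z K' t) - Real.log (Z K t) - c| ≤ vol * δ w K - Real.log (1 - W w K) := by
  intro w K K' hKK'
  obtain ⟨c, hc⟩ := pairMatching_of_offsetGoodClauses hvol hZA hZB hpos (hW1 w) hA hB (hbad w) (hWA w) (hWB w)
    (hgood w) K K' hKK'
  refine ⟨c, fun t ht => ?_⟩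
  rw [← mul_hybridDelta hvol.ne']
  exact hc t ht

/-- **THE WINDOWED SOCKET ⟹ PAIR-CAUCHY (`ε–K₀` form).**  With the data of `pairBound_of_windowedOffsetGoodClauses` and: at
each FIXED window `w` the remainder is null in `K` (`δ w K → 0`); the bad-class weights are eventually (in `K`) `≤ η w`, with
`η w < 1` and `η w → 0` (`w → ∞`) — deep bad classes uniformly light, NO summability — every `ε > 0` admits `K₀` beyond
which all pairs match within `ε`. [folklore] -/
theorem pairCauchy_of_windowedOffsetGoodClauses {Bad : ℕ → ℕ → ℕ → ℝ → Finset ι} {δ W : ℕ → ℕ → ℝ} {η : ℕ → ℝ}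
    (hvol : 0 < vol) (hZA : ∀ (K : ℕ) (t : ℝ), |t| ≤ l₀ → Z K t = ∑ τ ∈ T K, A K t τ)
    (hZB : ∀ (K K' : ℕ) (t : ℝ), K ≤ K' → |t| ≤ l₀ → Z K' t = ∑ τ ∈ T K, B K K' t τ)
    (hpos : ∀ (K : ℕ) (t : ℝ), |t| ≤ l₀ → 0 < ∑ τ ∈ T K, A K t τ) (hW1 : ∀ w K, W w K < 1)
    (hA : ∀ K t, |t| ≤ l₀ → ∀ τ ∈ T K, 0 ≤ A K t τ)
    (hB : ∀ K K' t, K ≤ K' → |t| ≤ l₀ → ∀ τ ∈ T K, 0 ≤ B K K' t τ)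
    (hbad : ∀ w K K' t, K ≤ K' → |t| ≤ l₀ → Bad w K K' t ⊆ T K)
    (hWA : ∀ w K K' t, K ≤ K' → |t| ≤ l₀ → ∑ τ ∈ Bad w K K' t, A K t τ ≤ W w K * ∑ τ ∈ T K, A K t τ)
    (hWB : ∀ w K K' t, K ≤ K' → |t| ≤ l₀ → ∑ τ ∈ Bad w K K' t, B K K' t τ ≤ W w K * ∑ τ ∈ T K, B K K' t τ)
    (hgood : ∀ w n : ℕ, GoodClause l₀ vol T A (fun K => B K (K + n)) (fun K => Bad w K (K + n)) (δ w))
    (hδ : ∀ w, Tendsto (δ w) atTop (𝓝 0)) (hWη : ∀ w, ∀ᶠ K in atTop, W w K ≤ η w) (hη1 : ∀ w, η w < 1)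
    (hη : Tendsto η atTop (𝓝 0)) :
    ∀ ε : ℝ, 0 < ε → ∃ K₀ : ℕ, ∀ K K' : ℕ, K₀ ≤ K → K ≤ K' →
      ∃ c : ℝ, ∀ t : ℝ, |t| ≤ l₀ → |Real.log (Z K' t) - Real.log (Z K t) - c| ≤ ε :=
  pairCauchy_of_windowedHybrid (D := δ) (W := W)
    (pairBound_of_windowedOffsetGoodClauses hvol hZA hZB hpos hW1 hA hB hbad hWA hWB hgood) hδ hWη hη1 hη

end Window

/-! ## §2 The K-ONLY pair bad class (the printed TYPE; PRICING-NE7 v8 §45 (iii) answered in kernel) -/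

section KOnly

variable {ι : Type*} [DecidableEq ι] {l₀ vol : ℝ} {T : ℕ → Finset ι} {A : ℕ → ℝ → ι → ℝ}
  {B : ℕ → ℕ → ℝ → ι → ℝ} {Z : ℕ → ℝ → ℝ}

/-- **THE K-ONLY WINDOWED PAIR BOUND.**  Bad classes `Bad w K t ⊆ T K` indexed by the window `w` and the COARSER run `K`
ONLY — the same set of labels for every finer partner `K′`; ONE-RUN weight in run `K`
(`Σ_{Bad w K t} A K t ≤ W w K·Σ_{T K} A K t`); ONE inequality for the finer run, uniform in the partner
(`Σ_{Bad w K t} B K K′ t ≤ W w K·Σ_{T K} B K K′ t` for all `K′ ≥ K`); per-offset good clauses on `T K ∖ Bad w K t` ⟹ the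
windowed pair bound of §1.  No intermediate run, no union over consecutive steps, no tail sum. [folklore] -/
theorem pairBound_of_kOnlyBadClasses {Bad : ℕ → ℕ → ℝ → Finset ι} {δ W : ℕ → ℕ → ℝ}
    (hvol : 0 < vol) (hZA : ∀ (K : ℕ) (t : ℝ), |t| ≤ l₀ → Z K t = ∑ τ ∈ T K, A K t τ)
    (hZB : ∀ (K K' : ℕ) (t : ℝ), K ≤ K' → |t| ≤ l₀ → Z K' t = ∑ τ ∈ T K, B K K' t τ)
    (hpos : ∀ (K : ℕ) (t : ℝ), |t| ≤ l₀ → 0 < ∑ τ ∈ T K, A K t τ) (hW1 : ∀ w K, W w K < 1)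
    (hA : ∀ K t, |t| ≤ l₀ → ∀ τ ∈ T K, 0 ≤ A K t τ)
    (hB : ∀ K K' t, K ≤ K' → |t| ≤ l₀ → ∀ τ ∈ T K, 0 ≤ B K K' t τ)
    (hbad : ∀ w K t, |t| ≤ l₀ → Bad w K t ⊆ T K)
    (hWA : ∀ w K t, |t| ≤ l₀ → ∑ τ ∈ Bad w K t, A K t τ ≤ W w K * ∑ τ ∈ T K, A K t τ)
    (hWB : ∀ w K K' t, K ≤ K' → |t| ≤ l₀ → ∑ τ ∈ Bad w K t, B K K' t τ ≤ W w K * ∑ τ ∈ T K, B K K' t τ)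
    (hgood : ∀ w n : ℕ, GoodClause l₀ vol T A (fun K => B K (K + n)) (fun K => Bad w K) (δ w)) :
    ∀ w K K' : ℕ, K ≤ K' → ∃ c : ℝ, ∀ t : ℝ, |t| ≤ l₀ →
      |Real.log (Z K' t) - Real.log (Z K t) - c| ≤ vol * δ w K - Real.log (1 - W w K) :=
  pairBound_of_windowedOffsetGoodClauses (Bad := fun w K _ t => Bad w K t) hvol hZA hZB hpos hW1 hA hB
    (fun w K _ t _ ht => hbad w K t ht) (fun w K _ t _ ht => hWA w K t ht) hWB hgood

/-- **K-ONLY BAD CLASSES ⟹ PAIR-CAUCHY**: the data of `pairBound_of_kOnlyBadClasses` with `δ w K → 0` at fixed `w`,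
`W w K ≤ η w` eventually in `K`, `η w < 1`, `η → 0` ⟹ the `ε–K₀` pair-Cauchy statement.  `W` is asked to be NULL ALONG THE
WINDOW LIMIT only — never summable. [folklore] -/
theorem pairCauchy_of_kOnlyBadClasses {Bad : ℕ → ℕ → ℝ → Finset ι} {δ W : ℕ → ℕ → ℝ} {η : ℕ → ℝ}
    (hvol : 0 < vol) (hZA : ∀ (K : ℕ) (t : ℝ), |t| ≤ l₀ → Z K t = ∑ τ ∈ T K, A K t τ)
    (hZB : ∀ (K K' : ℕ) (t : ℝ), K ≤ K' → |t| ≤ l₀ → Z K' t = ∑ τ ∈ T K, B K K' t τ)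
    (hpos : ∀ (K : ℕ) (t : ℝ), |t| ≤ l₀ → 0 < ∑ τ ∈ T K, A K t τ) (hW1 : ∀ w K, W w K < 1)
    (hA : ∀ K t, |t| ≤ l₀ → ∀ τ ∈ T K, 0 ≤ A K t τ)
    (hB : ∀ K K' t, K ≤ K' → |t| ≤ l₀ → ∀ τ ∈ T K, 0 ≤ B K K' t τ)
    (hbad : ∀ w K t, |t| ≤ l₀ → Bad w K t ⊆ T K)
    (hWA : ∀ w K t, |t| ≤ l₀ → ∑ τ ∈ Bad w K t, A K t τ ≤ W w K * ∑ τ ∈ T K, A K t τ)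
    (hWB : ∀ w K K' t, K ≤ K' → |t| ≤ l₀ → ∑ τ ∈ Bad w K t, B K K' t τ ≤ W w K * ∑ τ ∈ T K, B K K' t τ)
    (hgood : ∀ w n : ℕ, GoodClause l₀ vol T A (fun K => B K (K + n)) (fun K => Bad w K) (δ w))
    (hδ : ∀ w, Tendsto (δ w) atTop (𝓝 0)) (hWη : ∀ w, ∀ᶠ K in atTop, W w K ≤ η w) (hη1 : ∀ w, η w < 1)
    (hη : Tendsto η atTop (𝓝 0)) :
    ∀ ε : ℝ, 0 < ε → ∃ K₀ : ℕ, ∀ K K' : ℕ, K₀ ≤ K → K ≤ K' →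
      ∃ c : ℝ, ∀ t : ℝ, |t| ≤ l₀ → |Real.log (Z K' t) - Real.log (Z K t) - c| ≤ ε :=
  pairCauchy_of_windowedHybrid (D := δ) (W := W)
    (pairBound_of_kOnlyBadClasses hvol hZA hZB hpos hW1 hA hB hbad hWA hWB hgood) hδ hWη hη1 hη

end KOnly

/-! ## §3 Exits by name: node U6 and node U0 from K-only windowed data -/

section Exit

open Missing T4Continuum T4Assembly

variable {G : Type*} [GaugeGroup G] [MeasurableSpace G] [HaarData G] {O : Type*}

/-- **NODE U6 FROM K-ONLY WINDOWED DATA.**  Per string `os`: labels `T`, run-`K` terms `A`, run-`K′` terms fibre-summed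
`B K K′`, K-ONLY windowed bad classes `Bad w K t ⊆ T K` with one-run weight `≤ W w K` in run `K` and `≤ W w K` under every
finer run, per-offset good clauses at every window with remainders `δ w K → 0` (fixed `w`), `W w K < 1`, `W w K ≤ η w`
eventually, `η w < 1`, `η → 0` ⟹ `GenFunCauchy S l₀`. [folklore] -/
theorem genFunCauchy_of_kOnlyBadClasses {ι : Type*} [DecidableEq ι] (S : TorusScheme G O) {l₀ : ℝ} (hl₀ : 0 ≤ l₀)
    (h : ∀ os : List O, ∃ (vol : ℝ) (T : ℕ → Finset ι) (A : ℕ → ℝ → ι → ℝ) (B : ℕ → ℕ → ℝ → ι → ℝ)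
      (Bad : ℕ → ℕ → ℝ → Finset ι) (δ W : ℕ → ℕ → ℝ) (η : ℕ → ℝ), 0 < vol ∧
      (∀ w, Tendsto (δ w) atTop (𝓝 0)) ∧ (∀ w, ∀ᶠ K in atTop, W w K ≤ η w) ∧ (∀ w, η w < 1) ∧
      Tendsto η atTop (𝓝 0) ∧ (∀ w K, W w K < 1) ∧
      (∀ (K : ℕ) (t : ℝ), |t| ≤ l₀ → T4GenFunBounds.schemeZ S os K t = ∑ τ ∈ T K, A K t τ) ∧
      (∀ (K K' : ℕ) (t : ℝ), K ≤ K' → |t| ≤ l₀ → T4GenFunBounds.schemeZ S os K' t = ∑ τ ∈ T K, B K K' t τ) ∧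
      (∀ (K : ℕ) (t : ℝ), |t| ≤ l₀ → 0 < ∑ τ ∈ T K, A K t τ) ∧
      (∀ K t, |t| ≤ l₀ → ∀ τ ∈ T K, 0 ≤ A K t τ) ∧
      (∀ K K' t, K ≤ K' → |t| ≤ l₀ → ∀ τ ∈ T K, 0 ≤ B K K' t τ) ∧
      (∀ w K t, |t| ≤ l₀ → Bad w K t ⊆ T K) ∧
      (∀ w K t, |t| ≤ l₀ → ∑ τ ∈ Bad w K t, A K t τ ≤ W w K * ∑ τ ∈ T K, A K t τ) ∧
      (∀ w K K' t, K ≤ K' → |t| ≤ l₀ → ∑ τ ∈ Bad w K t, B K K' t τ ≤ W w K * ∑ τ ∈ T K, B K K' t τ) ∧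
      (∀ w n : ℕ, GoodClause l₀ vol T A (fun K => B K (K + n)) (fun K => Bad w K) (δ w))) :
    GenFunCauchy S l₀ := by
  intro os t ht
  obtain ⟨vol, T, A, B, Bad, δ, W, η, hvol, hδ, hWη, hη1, hη, hW1, hZA, hZB, hpos, hA, hB, hbad, hWA, hWB, hgood⟩ :=
    h os
  exact cauchySeq_genFun_of_pairCauchy hl₀
    (pairCauchy_of_kOnlyBadClasses hvol hZA hZB hpos hW1 hA hB hbad hWA hWB hgood hδ hWη hη1 hη) ht

/-- … and NODE U0 (`Missing.HasContinuumLimit S`) by `T4Assembly.hasContinuumLimit_of_genFunCauchy`. [folklore] -/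
theorem hasContinuumLimit_of_kOnlyBadClasses [RegularGaugeGroup G] {ι : Type*} [DecidableEq ι]
    (S : TorusScheme G O) (hβ : ∀ K, 0 ≤ S.β K) (hm : ∀ K o, Measurable (S.obs K o))
    (h1 : ∀ K o U, |S.obs K o U| ≤ 1) {l₀ : ℝ} (hl₀ : 0 < l₀)
    (h : ∀ os : List O, ∃ (vol : ℝ) (T : ℕ → Finset ι) (A : ℕ → ℝ → ι → ℝ) (B : ℕ → ℕ → ℝ → ι → ℝ)
      (Bad : ℕ → ℕ → ℝ → Finset ι) (δ W : ℕ → ℕ → ℝ) (η : ℕ → ℝ), 0 < vol ∧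
      (∀ w, Tendsto (δ w) atTop (𝓝 0)) ∧ (∀ w, ∀ᶠ K in atTop, W w K ≤ η w) ∧ (∀ w, η w < 1) ∧
      Tendsto η atTop (𝓝 0) ∧ (∀ w K, W w K < 1) ∧
      (∀ (K : ℕ) (t : ℝ), |t| ≤ l₀ → T4GenFunBounds.schemeZ S os K t = ∑ τ ∈ T K, A K t τ) ∧
      (∀ (K K' : ℕ) (t : ℝ), K ≤ K' → |t| ≤ l₀ → T4GenFunBounds.schemeZ S os K' t = ∑ τ ∈ T K, B K K' t τ) ∧
      (∀ (K : ℕ) (t : ℝ), |t| ≤ l₀ → 0 < ∑ τ ∈ T K, A K t τ) ∧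
      (∀ K t, |t| ≤ l₀ → ∀ τ ∈ T K, 0 ≤ A K t τ) ∧
      (∀ K K' t, K ≤ K' → |t| ≤ l₀ → ∀ τ ∈ T K, 0 ≤ B K K' t τ) ∧
      (∀ w K t, |t| ≤ l₀ → Bad w K t ⊆ T K) ∧
      (∀ w K t, |t| ≤ l₀ → ∑ τ ∈ Bad w K t, A K t τ ≤ W w K * ∑ τ ∈ T K, A K t τ) ∧
      (∀ w K K' t, K ≤ K' → |t| ≤ l₀ → ∑ τ ∈ Bad w K t, B K K' t τ ≤ W w K * ∑ τ ∈ T K, B K K' t τ) ∧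
      (∀ w n : ℕ, GoodClause l₀ vol T A (fun K => B K (K + n)) (fun K => Bad w K) (δ w))) :
    Missing.HasContinuumLimit S :=
  hasContinuumLimit_of_genFunCauchy S hβ hm h1 hl₀ (genFunCauchy_of_kOnlyBadClasses S hl₀.le h)

end Exit

/-! ## §4 Contrast: what the rejected union-of-consecutive bad class would cost -/

section Contrast

variable {ι κ : Type*} [DecidableEq ι]

/-- The weight of a finite UNION is at most the SUM of the weights of its pieces (nonnegative weights). [folklore] -/
theorem sum_biUnion_le_sum_sum_of_nonneg (s : Finset κ) (t : κ → Finset ι) {a : ι → ℝ} (ha : ∀ i, 0 ≤ a i) :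
    ∑ i ∈ s.biUnion t, a i ≤ ∑ k ∈ s, ∑ i ∈ t k, a i := by
  classical
  induction s using Finset.induction_on with
  | empty => simp
  | insert k s hk ih =>
    rw [Finset.biUnion_insert, Finset.sum_insert hk]
    have hu := Finset.sum_union_inter (s₁ := t k) (s₂ := s.biUnion t) (f := a)
    have hi : 0 ≤ ∑ i ∈ t k ∩ s.biUnion t, a i := sum_nonneg fun i _ => ha i
    linarith

/-- **THE UNION-OF-CONSECUTIVE BAD CLASS PAYS THE TAIL SUM.**  If each per-step bad class `Bad₁ m` has weight
`≤ W₁ m · total`, the union over the steps `m ∈ [K, K′)` is bounded only by `(Σ_{m ∈ [K, K′)} W₁ m) · total` — for this to be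
small uniformly in `K′` one needs `Σ_{m ≥ K} W₁ m → 0`, i.e. `Summable W₁` («in costume», PRICING-NE7 v8 §45 (iii)).  The
K-only class of §2 never forms this union. [folklore] -/
theorem sum_biUnion_le_sum_mul (Bad₁ : ℕ → Finset ι) {a : ι → ℝ} (ha : ∀ i, 0 ≤ a i) {W₁ : ℕ → ℝ} {total : ℝ}
    (hW : ∀ m, ∑ i ∈ Bad₁ m, a i ≤ W₁ m * total) (K K' : ℕ) :
    ∑ i ∈ (Finset.Ico K K').biUnion Bad₁, a i ≤ (∑ m ∈ Finset.Ico K K', W₁ m) * total := by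
  refine (sum_biUnion_le_sum_sum_of_nonneg (Finset.Ico K K') Bad₁ ha).trans ?_
  rw [Finset.sum_mul]
  exact Finset.sum_le_sum fun m _ => hW m

end Contrast

end Summit.QuantumFields.BalabanUV.T4Continuum.NE7PairwiseOffsetEndWindow

end
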